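import Literature.Probability.Percolation.Ports
import Literature.Probability.Percolation.GluingChainStructure
import HarnessLib

/-!
# The crossing event of the cut quad as a function of the explored data and the docking bits

Topic `Probability/Percolation`.  Support file (definitions and proofs, no named fact) for step (C)
of the proof of Schramm–Smirnov's Prop. 4.1 (Ann. Probab. 39 (2011), §4: "ω̃ ∈ ⊞_{Q₀} if and only
if there is a path from ∂₀Q₀ to ∂₂Q₀ in G ∪ G*").  The exact structure theorem
`QuadCrossing.mem_z2QuadConfig_iff_chain` (an alternating chain of revealed pieces and accessible
open walks between hub vertices) is rewritten at the resolution of the SIDES of the traced boundary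
loop of the link domain `U` of a tile domain `𝒯`: an accessible open walk between hub vertices
splits at its hub vertices into pieces docking, at both ends, on hub contacts of the loop
(`exists_dockChain_of_accAdj`); so the quad is crossed iff `∂₀Q` is joined to `∂₂Q` in the graph
on the loop sides whose edges are the REVEALED relation `Gst` (revealed open pieces between attached
hub vertices) and the FRESH relation `Bit` (an open walk of `U` docking at the two sides)
(`mem_z2QuadConfig_iff_sideChain`).  The bits depend on the configuration only through the
accessible fresh edges; contracting the ports (owner constancy, `PortRuns`) turns them into the
crossing events of the link quads (`Ports.mem_z2QuadConfig_linkQuad_iff_docking`), in the sequel.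

## References

* O. Schramm, S. Smirnov, *On the scaling limits of planar percolation*, Ann. Probab. 39 (2011)
  1768–1814, arXiv:1101.5820, §4, proof of Prop. 4.1. [SchrammSmirnov2011]
-/

noncomputable section

open Set Relation
open Literature.Probability.LatticeModels
open scoped Classical

namespace Literature.Probability.Percolation

namespace CellComplex

namespace TileData

open QuadCrossing

variable {𝒯 : TileData} {d₀ : Site 2 × Fin 4}

/-! ### Docking darts and the loop side carrying them -/

/-- The segment of a dart and of its reverse coincide. [folklore] -/
theorem edgeSeg_rev (v : Site 2) (k : Fin 4) : edgeSeg (v + cornerUnit k) (k + 2) = edgeSeg v k := by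
  rw [edgeSeg, edgeSeg, cornerUnit_add_two, add_neg_cancel_right, segment_symm]

/-- A vertex off `U` carrying an accessible edge is a hub vertex. [folklore] -/
theorem mem_O_of_dock {x : Site 2} {k : Fin 4} (hσ : σc x ∉ 𝒯.U) (hβ : βc x k ∈ 𝒯.U) : x ∈ 𝒯.O := by
  by_contra hxO
  exact hσ ((σc_mem_U_iff 𝒯).2 ⟨hxO, _, (βc_mem_U_iff 𝒯).1 hβ, mem_dartEdge_iff.2 (Or.inl rfl)⟩)

/-- The vertices attached to a hub site cell. [folklore] -/
theorem mem_att_σc_iff {x v : Site 2} : v ∈ 𝒯.att (σc x) ↔ v = x ∧ x ∈ 𝒯.O := by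
  constructor
  · rintro ⟨hvO, h | ⟨m, h⟩⟩
    · obtain rfl := σc_injective h
      exact ⟨rfl, hvO⟩
    · exact absurd h (σc_ne_βc x v m)
  · rintro ⟨rfl, hxO⟩
    exact ⟨hxO, Or.inl rfl⟩

/-- **The loop side of a docking dart**: if `σ x ∉ U` and `β x k ∈ U`, the contact point of the dart
lies on a side of the traced loop, which is a hub contact with out-cell `σ x` and attached vertex
`x`. [folklore] -/
theorem exists_side_of_dock (h₀ : IsBd 𝒯.U d₀) {x : Site 2} {k : Fin 4} (hσ : σc x ∉ 𝒯.U) (hβ : βc x k ∈ 𝒯.U) :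
    ∃ i < period h₀, cpt x k ∈ edgeSeg (vert 𝒯.U d₀ i) (dirAt 𝒯.U d₀ i) ∧ 𝒯.outCell d₀ i = σc x ∧
      𝒯.hubContact d₀ i ∧ x ∈ 𝒯.att (𝒯.outCell d₀ i) := by
  -- the reversed contact dart is a boundary dart, hence on the loop
  set d : Site 2 × Fin 4 := ((contactDart x k).1 + cornerUnit (contactDart x k).2, (contactDart x k).2 + 2) with hd
  have hbd : IsBd 𝒯.U d := by
    obtain ⟨hL, hR⟩ := faceAt_contactDart_rev x k
    exact ⟨hL.symm ▸ hβ, hR.symm ▸ hσ⟩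
  obtain ⟨i, hi, hid⟩ := exists_eq_bdOrbit_of_isBd h₀ 𝒯.pinchFree 𝒯.edgeConn 𝒯.coHoleFree hbd
  have hmem : cpt x k ∈ edgeSeg (vert 𝒯.U d₀ i) (dirAt 𝒯.U d₀ i) := by
    rw [show vert 𝒯.U d₀ i = d.1 from congrArg Prod.fst hid, show dirAt 𝒯.U d₀ i = d.2 from congrArg Prod.snd hid,
      hd, edgeSeg_rev, cpt_eq_emid]
    exact emid_mem_edgeSeg _ _
  exact ⟨i, hi, hmem, 𝒯.hubContact_of_docking h₀ (mem_O_of_dock hσ hβ) hβ hmem⟩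

/-! ### The junction hypothesis of the structure theorem -/

/-- **Junctions are hub vertices**: an open accessible edge followed by an open inaccessible edge
meet at a hub vertex — when examined closed edges are closed and edges leaving the window are
examined. [folklore] -/
theorem junction_mem_O {η : BondConfig (Site 2)} (hcons : ∀ e ∈ 𝒯.clE, e ∉ η)
    (hX : ∀ e ∈ (zdGraph 2).edgeSet, (∃ v ∈ e, v ∈ 𝒯.Wv) → (∃ u ∈ e, u ∉ 𝒯.Wv) → e ∈ 𝒯.hubE ∨ e ∈ 𝒯.clE) :
    ∀ u v w : Site 2, (zdGraph 2).Adj u v → (zdGraph 2).Adj v w → s(u, v) ∈ η → s(v, w) ∈ η →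
      s(u, v) ∈ (↑𝒯.acc : Set (Sym2 (Site 2))) → s(v, w) ∉ (↑𝒯.acc : Set (Sym2 (Site 2))) → v ∈ 𝒯.O := by
  intro u v w _ hadj huvη hvwη huv hvw
  by_contra hvO
  have huv' : s(u, v) ∈ 𝒯.acc := huv
  have hvW : v ∈ 𝒯.Wv := 𝒯.acc_window _ huv' v (Sym2.mem_mk_right u v)
  have hvwE : s(v, w) ∈ (zdGraph 2).edgeSet := (SimpleGraph.mem_edgeSet (G := zdGraph 2)).2 hadj
  by_cases hwW : w ∈ 𝒯.Wv
  · -- a window edge at an accessible non-hub vertex is examined or accessible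
    rcases 𝒯.closure _ huv' v (Sym2.mem_mk_right u v) hvO _ hvwE (Sym2.mem_mk_left v w)
      (fun z hz => by rcases Sym2.mem_iff.1 hz with rfl | rfl <;> assumption) with h | h | h
    · exact hvO (𝒯.hub_O _ h v (Sym2.mem_mk_left v w))
    · exact hcons _ h hvwη
    · exact hvw h
  · rcases hX _ hvwE ⟨v, Sym2.mem_mk_left v w, hvW⟩ ⟨w, Sym2.mem_mk_right v w, hwW⟩ with h | h
    · exact hvO (𝒯.hub_O _ h v (Sym2.mem_mk_left v w))
    · exact hcons _ h hvwη

/-! ### Splitting an accessible open walk at its hub vertices -/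

/-- **A docking piece**: hub vertices `a, a'` joined by an open accessible walk whose first and last
darts dock (their bond cells are in `U`) and whose interior runs through `U`. [folklore] -/
def DockPiece (η : BondConfig (Site 2)) (a a' : Site 2) : Prop :=
  ∃ k k' : Fin 4, σc a ∉ 𝒯.U ∧ βc a k ∈ 𝒯.U ∧ dartEdge a k ∈ η ∧ σc a' ∉ 𝒯.U ∧ βc a' k' ∈ 𝒯.U ∧ dartEdge a' k' ∈ η ∧
    ReflTransGen (OpenStep 𝒯.U η) (a + cornerUnit k) (a' + cornerUnit k')

/-- One step of an accessible open walk from a hub vertex docks. [folklore] -/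
theorem dock_of_accAdj {η : BondConfig (Site 2)} {a v : Site 2} (haO : a ∈ 𝒯.O)
    (h : AccAdj η (↑𝒯.acc) a v) : ∃ k : Fin 4, v = a + cornerUnit k ∧ σc a ∉ 𝒯.U ∧ βc a k ∈ 𝒯.U ∧ dartEdge a k ∈ η := by
  obtain ⟨hadj, hη, hacc⟩ := h
  obtain ⟨k, rfl⟩ := adj_iff_exists_cornerUnit.1 hadj
  refine ⟨k, rfl, fun hσ => ((σc_mem_U_iff 𝒯).1 hσ).1 haO, (βc_mem_U_iff 𝒯).2 hacc, hη⟩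

/-- A step of an accessible open walk between non-hub vertices is an `OpenStep` of `U`. [folklore] -/
theorem openStep_of_accAdj {η : BondConfig (Site 2)} {u v : Site 2} (huO : u ∉ 𝒯.O) (hvO : v ∉ 𝒯.O)
    (h : AccAdj η (↑𝒯.acc) u v) : OpenStep 𝒯.U η u v := by
  obtain ⟨hadj, hη, hacc⟩ := h
  obtain ⟨k, rfl⟩ := adj_iff_exists_cornerUnit.1 hadj
  have hacc' : dartEdge u k ∈ 𝒯.acc := hacc
  exact ⟨(σc_mem_U_iff 𝒯).2 ⟨huO, _, hacc', mem_dartEdge_iff.2 (Or.inl rfl)⟩,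
    (σc_mem_U_iff 𝒯).2 ⟨hvO, _, hacc', mem_dartEdge_iff.2 (Or.inr rfl)⟩, k, rfl, hη⟩

/-- **Splitting at hub vertices**: an accessible open walk between hub vertices is a chain of
docking pieces between hub vertices. [folklore] -/
theorem exists_dockChain_of_accAdj {η : BondConfig (Site 2)} {a b : Site 2} (haO : a ∈ 𝒯.O) (hbO : b ∈ 𝒯.O)
    (h : ReflTransGen (AccAdj η (↑𝒯.acc)) a b) :
    ReflTransGen (fun x y => x ∈ 𝒯.O ∧ y ∈ 𝒯.O ∧ 𝒯.DockPiece η x y) a b := by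
  -- induction on the length of a vertex list of the walk
  obtain ⟨l, hchain, hlast⟩ := List.exists_isChain_cons_of_relationReflTransGen h
  suffices H : ∀ (n : ℕ) (a : Site 2) (l : List (Site 2)), l.length = n → a ∈ 𝒯.O →
      List.IsChain (AccAdj η (↑𝒯.acc)) (a :: l) → (a :: l).getLast (List.cons_ne_nil a l) ∈ 𝒯.O →
      ReflTransGen (fun x y => x ∈ 𝒯.O ∧ y ∈ 𝒯.O ∧ 𝒯.DockPiece η x y) a ((a :: l).getLast (List.cons_ne_nil a l)) by
    have := H l.length a l rfl haO hchain (hlast.symm ▸ hbO)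
    rwa [hlast] at this
  intro n
  induction n using Nat.strong_induction_on with
  | _ n ih =>
    intro a l hl haO hchain hbO
    rcases l with _ | ⟨v, l⟩
    · simpa using ReflTransGen.refl
    · -- the first dart docks; follow the walk to the first hub vertex
      have hn : n = l.length + 1 := by simpa using hl.symm
      have hav : AccAdj η (↑𝒯.acc) a v := hchain.rel
      obtain ⟨k, rfl, hσa, hβa, hηa⟩ := dock_of_accAdj haO hav
      have hvO : a + cornerUnit k ∉ 𝒯.O := by
        obtain ⟨w, hw, hwO⟩ := 𝒯.acc_nonO _ (hav.2.2 : dartEdge a k ∈ 𝒯.acc)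
        rcases mem_dartEdge_iff.1 hw with rfl | rfl
        · exact absurd haO hwO
        · exact hwO
      -- scan the rest: positions in `l` (after `v`) of the first hub vertex
      have hchain' : List.IsChain (AccAdj η (↑𝒯.acc)) ((a + cornerUnit k) :: l) := hchain.tail
      -- generalised scan: from a non-hub vertex `u` reached from the dock by `OpenStep`s
      have scan : ∀ (l' : List (Site 2)) (u : Site 2), l'.length ≤ l.length → u ∉ 𝒯.O →
          ReflTransGen (OpenStep 𝒯.U η) (a + cornerUnit k) u →
          List.IsChain (AccAdj η (↑𝒯.acc)) (u :: l') → (u :: l').getLast (List.cons_ne_nil u l') ∈ 𝒯.O →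
          ReflTransGen (fun x y => x ∈ 𝒯.O ∧ y ∈ 𝒯.O ∧ 𝒯.DockPiece η x y) a ((u :: l').getLast (List.cons_ne_nil u l')) := by
        intro l'
        induction l' with
        | nil =>
          intro u _ huO _ _ hlastO
          exact absurd (by simpa using hlastO) huO
        | cons w l' ihl =>
          intro u hlen huO hpath hch hlastO
          have huw : AccAdj η (↑𝒯.acc) u w := hch.rel
          by_cases hwO : w ∈ 𝒯.O
          · -- the piece ends at the hub vertex `w`: its last dart docks (reversed)
            obtain ⟨k', rfl, hσw, hβw, hηw⟩ := dock_of_accAdj hwO huw.symm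
            have hpiece : 𝒯.DockPiece η a w :=
              ⟨k, k', hσa, hβa, hηa, hσw, hβw, hηw, hpath⟩
            -- continue from `w` by the outer induction
            have hrest := ih l'.length (by simp at hlen ⊢; omega) w l' rfl hwO hch.tail (by simpa using hlastO)
            have hfirst : ReflTransGen (fun x y => x ∈ 𝒯.O ∧ y ∈ 𝒯.O ∧ 𝒯.DockPiece η x y) a w :=
              ReflTransGen.single ⟨haO, hwO, hpiece⟩
            simpa [List.getLast_cons_cons] using hfirst.trans hrest
          · have hstep : OpenStep 𝒯.U η u w := openStep_of_accAdj huO hwO huw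
            have := ihl w (by simp at hlen ⊢; omega) hwO (hpath.tail hstep) hch.tail (by simpa using hlastO)
            simpa [List.getLast_cons_cons] using this
      have := scan l (a + cornerUnit k) le_rfl hvO ReflTransGen.refl hchain' (by simpa using hbO)
      simpa [List.getLast_cons_cons] using this

/-! ### The side-level relations -/

section SideChain

variable {D : Set ℂ} {δ : ℝ}

variable (𝒯) in
/-- **Revealed connection**: a preconnected set of drawn revealed (inaccessible) open edges inside
the carrier joining the two points. [cite: SchrammSmirnov2011, §4, proof of Prop. 4.1 (the graph G)] -/
def RevPt (Q : Quad D) (δ : ℝ) (η : BondConfig (Site 2)) (p q : ℂ) : Prop :=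
  ∃ S ⊆ openEdgeUnion δ (η \ ↑𝒯.acc) ∩ Q.carrier, IsPreconnected S ∧ p ∈ S ∧ q ∈ S

variable {Q : Quad D} {η : BondConfig (Site 2)}

/-- `RevPt` is reflexive at drawn revealed points of the carrier. [folklore] -/
theorem RevPt.of_mem {p : ℂ} (hp : p ∈ openEdgeUnion δ (η \ ↑𝒯.acc)) (hpQ : p ∈ Q.carrier) : 𝒯.RevPt Q δ η p p :=
  ⟨{p}, by simpa using And.intro hp hpQ, isPreconnected_singleton, rfl, rfl⟩

/-- `RevPt` is symmetric. [folklore] -/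
theorem RevPt.symm {p q : ℂ} (h : 𝒯.RevPt Q δ η p q) : 𝒯.RevPt Q δ η q p := by
  obtain ⟨S, hS, hSc, hp, hq⟩ := h; exact ⟨S, hS, hSc, hq, hp⟩

/-- `RevPt` is transitive. [folklore] -/
theorem RevPt.trans {p q r : ℂ} (h : 𝒯.RevPt Q δ η p q) (h' : 𝒯.RevPt Q δ η q r) : 𝒯.RevPt Q δ η p r := by
  obtain ⟨S, hS, hSc, hp, hq⟩ := h
  obtain ⟨S', hS', hSc', hq', hr⟩ := h'
  exact ⟨S ∪ S', union_subset hS hS', hSc.union q hq hq' hSc', Or.inl hp, Or.inr hr⟩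

/-- The endpoints of `RevPt` lie in the carrier, on drawn revealed edges. [folklore] -/
theorem RevPt.mem_right {p q : ℂ} (h : 𝒯.RevPt Q δ η p q) : q ∈ openEdgeUnion δ (η \ ↑𝒯.acc) ∧ q ∈ Q.carrier := by
  obtain ⟨S, hS, -, -, hq⟩ := h; exact hS hq

variable (𝒯 d₀) in
/-- **Revealed step between loop sides**: attached hub vertices of the two sides joined by a revealed
connection. [cite: SchrammSmirnov2011, §4, proof of Prop. 4.1 (the graph G)] -/
def Gst (Q : Quad D) (δ : ℝ) (η : BondConfig (Site 2)) (i j : ℕ) : Prop :=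
  𝒯.hubContact d₀ i ∧ 𝒯.hubContact d₀ j ∧
    ∃ v ∈ 𝒯.att (𝒯.outCell d₀ i), ∃ v' ∈ 𝒯.att (𝒯.outCell d₀ j), 𝒯.RevPt Q δ η (meshPoint δ v) (meshPoint δ v')

variable (𝒯 d₀) in
/-- **Docking at a loop side**: a dart from a vertex off `U` whose bond cell is in `U`, open, with
contact point on the `i`-th side. [folklore] -/
def DockAt (η : BondConfig (Site 2)) (i : ℕ) (x : Site 2) (k : Fin 4) : Prop :=
  σc x ∉ 𝒯.U ∧ βc x k ∈ 𝒯.U ∧ dartEdge x k ∈ η ∧ cpt x k ∈ edgeSeg (vert 𝒯.U d₀ i) (dirAt 𝒯.U d₀ i)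

variable (𝒯 d₀) in
/-- **The docking bit** of a pair of loop sides: dockings at the two sides joined by an open walk
through `U`.  A function of the configuration on the accessible fresh edges only.
[cite: SchrammSmirnov2011, §4, proof of Prop. 4.1 (the graph G*)] -/
def Bit (η : BondConfig (Site 2)) (i j : ℕ) : Prop :=
  ∃ (x : Site 2) (k : Fin 4) (x' : Site 2) (k' : Fin 4), 𝒯.DockAt d₀ η i x k ∧ 𝒯.DockAt d₀ η j x' k' ∧
    ReflTransGen (OpenStep 𝒯.U η) (x + cornerUnit k) (x' + cornerUnit k')

variable (𝒯 d₀) in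
/-- Start: a point of `∂₀Q` on a drawn open edge joined by a revealed connection to a hub vertex
attached to the `i`-th side. [folklore] -/
def StartAt (Q : Quad D) (δ : ℝ) (η : BondConfig (Site 2)) (z₀ : ℂ) (i : ℕ) : Prop :=
  𝒯.hubContact d₀ i ∧ ∃ v ∈ 𝒯.att (𝒯.outCell d₀ i), 𝒯.RevPt Q δ η z₀ (meshPoint δ v)

variable (𝒯 d₀) in
/-- End: a hub vertex attached to the `j`-th side joined by a revealed connection to `∂₂Q`. [folklore] -/
def EndAt (Q : Quad D) (δ : ℝ) (η : BondConfig (Site 2)) (j : ℕ) (z₂ : ℂ) : Prop :=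
  𝒯.hubContact d₀ j ∧ ∃ v ∈ 𝒯.att (𝒯.outCell d₀ j), 𝒯.RevPt Q δ η (meshPoint δ v) z₂

/-! ### Auxiliary facts -/

/-- A hub vertex of the window carries an examined open edge, so its mesh point lies on a drawn
revealed open edge. [folklore] -/
theorem meshPoint_mem_openEdgeUnion_of_hub (hhubη : ∀ e ∈ 𝒯.hubE, e ∈ η) {x : Site 2} (hxO : x ∈ 𝒯.O)
    (hxW : x ∈ 𝒯.Wv) : meshPoint δ x ∈ openEdgeUnion δ (η \ ↑𝒯.acc) := by
  obtain ⟨u, huW, hpath⟩ := 𝒯.esc_O x hxO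
  -- the walk is nontrivial: its first edge is an examined open edge at `x`
  obtain ⟨y, hxy⟩ : ∃ y, s(x, y) ∈ 𝒯.hubE := by
    induction hpath using ReflTransGen.head_induction_on with
    | refl => exact absurd hxW huW
    | head h _ _ => exact ⟨_, h⟩
  have hadj : (zdGraph 2).Adj x y := (SimpleGraph.mem_edgeSet (G := zdGraph 2)).1 (𝒯.hub_edge _ hxy)
  rw [mem_openEdgeUnion_iff]
  exact ⟨x, y, hadj, ⟨hhubη _ hxy, fun h => 𝒯.acc_not_hub _ h hxy⟩, left_mem_segment _ _ _⟩

/-- A docking vertex is a hub vertex of the window whose mesh point lies in the carrier (the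
docking edge is drawn inside it). [folklore] -/
theorem dock_facts (hacc : ∀ u v : Site 2, AccAdj η (↑𝒯.acc) u v → segment ℝ (meshPoint δ u) (meshPoint δ v) ⊆ Q.carrier)
    {x : Site 2} {k : Fin 4} (hσ : σc x ∉ 𝒯.U) (hβ : βc x k ∈ 𝒯.U) (hη : dartEdge x k ∈ η) :
    x ∈ 𝒯.O ∧ x ∈ 𝒯.Wv ∧ meshPoint δ x ∈ Q.carrier ∧ AccAdj η (↑𝒯.acc) x (x + cornerUnit k) := by
  have hacc' : dartEdge x k ∈ 𝒯.acc := (βc_mem_U_iff 𝒯).1 hβ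
  have hA : AccAdj η (↑𝒯.acc) x (x + cornerUnit k) := ⟨adj_iff_exists_cornerUnit.2 ⟨k, rfl⟩, hη, hacc'⟩
  exact ⟨mem_O_of_dock hσ hβ, 𝒯.acc_window _ hacc' x (mem_dartEdge_iff.2 (Or.inl rfl)),
    hacc _ _ hA (left_mem_segment _ _ _), hA⟩

/-- An `OpenStep` of `U` is an accessible open step. [folklore] -/
theorem accAdj_of_openStep {u v : Site 2} (h : OpenStep 𝒯.U η u v) : AccAdj η (↑𝒯.acc) u v := by
  obtain ⟨hu, hv, k, rfl, hη⟩ := h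
  exact ⟨adj_iff_exists_cornerUnit.2 ⟨k, rfl⟩, hη, (βc_mem_U_iff 𝒯).1 (𝒯.βc_mem_of_σc_mem hu hv)⟩

/-- **Bridging inside a hub cell**: two vertices attached to the same hub cell have revealed-connected
mesh points, provided one of them is a drawn revealed point of the carrier and examined open edges
are drawn inside the carrier. [folklore] -/
theorem revPt_of_att (hhubη : ∀ e ∈ 𝒯.hubE, e ∈ η)
    (hhubQ : ∀ (y : Site 2) (m : Fin 4), dartEdge y m ∈ 𝒯.hubE →
      segment ℝ (meshPoint δ y) (meshPoint δ (y + cornerUnit m)) ⊆ Q.carrier)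
    {c v v' : Site 2} (hc : 𝒯.IsHubCell c) (hv : v ∈ 𝒯.att c) (hv' : v' ∈ 𝒯.att c)
    (hvpt : meshPoint δ v ∈ openEdgeUnion δ (η \ ↑𝒯.acc) ∧ meshPoint δ v ∈ Q.carrier) :
    𝒯.RevPt Q δ η (meshPoint δ v) (meshPoint δ v') := by
  rcases hc with ⟨x, hxO, rfl⟩ | ⟨y, m, hhub, rfl⟩
  · obtain ⟨rfl, -⟩ := mem_att_σc_iff.1 hv
    obtain ⟨rfl, -⟩ := mem_att_σc_iff.1 hv'
    exact RevPt.of_mem hvpt.1 hvpt.2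
  · -- both are endpoints of the examined open edge `dartEdge y m`, drawn inside the carrier
    have hends : ∀ w ∈ 𝒯.att (βc y m), w ∈ dartEdge y m := by
      rintro w ⟨-, h | ⟨m', h⟩⟩
      · exact absurd h.symm (σc_ne_βc w y m)
      · have : dartEdge y m = dartEdge w m' :=
          bcell_injOn (dartEdge_mem_edgeSet _ _) (dartEdge_mem_edgeSet _ _) (by rw [bcell_dartEdge, bcell_dartEdge, h])
        rw [this]; exact mem_dartEdge_iff.2 (Or.inl rfl)
    set S : Set ℂ := segment ℝ (meshPoint δ y) (meshPoint δ (y + cornerUnit m)) with hS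
    have hSsub : S ⊆ openEdgeUnion δ (η \ ↑𝒯.acc) ∩ Q.carrier := by
      refine subset_inter (fun z hz => ?_) (hhubQ y m hhub)
      rw [mem_openEdgeUnion_iff]
      exact ⟨y, y + cornerUnit m, adj_iff_exists_cornerUnit.2 ⟨m, rfl⟩, ⟨hhubη _ hhub, fun h => 𝒯.acc_not_hub _ h hhub⟩, hz⟩
    have hmemS : ∀ w ∈ dartEdge y m, meshPoint δ w ∈ S := by
      intro w hw
      rcases mem_dartEdge_iff.1 hw with rfl | rfl
      · exact left_mem_segment _ _ _
      · exact right_mem_segment _ _ _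
    exact ⟨S, hSsub, (convex_segment _ _).isPreconnected, hmemS v (hends v hv), hmemS v' (hends v' hv')⟩

/-! ### The theorem -/

variable (h₀ : IsBd 𝒯.U d₀) (hδ : 0 < δ)
  (hcons : ∀ e ∈ 𝒯.clE, e ∉ η)
  (hX : ∀ e ∈ (zdGraph 2).edgeSet, (∃ v ∈ e, v ∈ 𝒯.Wv) → (∃ u ∈ e, u ∉ 𝒯.Wv) → e ∈ 𝒯.hubE ∨ e ∈ 𝒯.clE)
  (hhubη : ∀ e ∈ 𝒯.hubE, e ∈ η)
  (hhubQ : ∀ (y : Site 2) (m : Fin 4), dartEdge y m ∈ 𝒯.hubE →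
    segment ℝ (meshPoint δ y) (meshPoint δ (y + cornerUnit m)) ⊆ Q.carrier)
  (h0 : Disjoint (Q.side 0) (openEdgeUnion δ (η ∩ ↑𝒯.acc))) (h2 : Disjoint (Q.side 2) (openEdgeUnion δ (η ∩ ↑𝒯.acc)))
  (hacc : ∀ u v : Site 2, AccAdj η (↑𝒯.acc) u v → segment ℝ (meshPoint δ u) (meshPoint δ v) ⊆ Q.carrier)
include h₀ hδ hcons hX hhubη hhubQ h0 h2 hacc

omit h₀ hδ hcons hX hhubη hhubQ h2 hacc in
/-- A point of `∂₀Q` on a drawn open edge lies on a drawn revealed open edge. [folklore] -/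
theorem mem_openEdgeUnion_sdiff_of_side0 {z : ℂ} (hz : z ∈ Q.side 0) (hzO : z ∈ openEdgeUnion δ η) :
    z ∈ openEdgeUnion δ (η \ ↑𝒯.acc) := by
  rw [mem_openEdgeUnion_iff] at hzO ⊢
  obtain ⟨x, y, hxy, hη, hz'⟩ := hzO
  refine ⟨x, y, hxy, ⟨hη, fun hacc' => ?_⟩, hz'⟩
  exact Set.disjoint_left.1 h0 hz (mem_openEdgeUnion_iff.2 ⟨x, y, hxy, ⟨hη, hacc'⟩, hz'⟩)

omit hcons hX h0 h2 in
/-- **(⇐) Soundness of the side chain.** [cite: SchrammSmirnov2011, §4, proof of Prop. 4.1] -/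
theorem mem_z2QuadConfig_of_sideChain {z₀ z₂ : ℂ} (hz₀ : z₀ ∈ Q.side 0) (hz₀O : z₀ ∈ openEdgeUnion δ η) (hz₂ : z₂ ∈ Q.side 2)
    (h : 𝒯.RevPt Q δ η z₀ z₂ ∨ ∃ i j, 𝒯.StartAt d₀ Q δ η z₀ i ∧
      ReflTransGen (fun a b => 𝒯.Gst d₀ Q δ η a b ∨ 𝒯.Bit d₀ η a b) i j ∧ 𝒯.EndAt d₀ Q δ η j z₂) :
    Q ∈ z2QuadConfig D δ η := by
  rw [mem_z2QuadConfig_iff_exists_isCrossing hδ]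
  refine exists_isCrossing_of_chain hδ Q (O := 𝒯.O) hacc hz₀ hz₀O hz₂ ?_
  have revStep : ∀ {p q}, 𝒯.RevPt Q δ η p q → ChainStep Q δ η (↑𝒯.acc) 𝒯.O p q :=
    fun ⟨S, hS, hSc, hp, hq⟩ => Or.inl ⟨S, hS, hSc, hp, hq⟩
  rcases h with h | ⟨i, j, ⟨hhubi, v₀, hv₀, hstart⟩, hchain, hend⟩
  · exact ReflTransGen.single (revStep h)
  · -- invariant along the side chain
    have key : ∀ j, ReflTransGen (fun a b => 𝒯.Gst d₀ Q δ η a b ∨ 𝒯.Bit d₀ η a b) i j →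
        ∃ v ∈ 𝒯.att (𝒯.outCell d₀ j), 𝒯.hubContact d₀ j ∧
          (meshPoint δ v ∈ openEdgeUnion δ (η \ ↑𝒯.acc) ∧ meshPoint δ v ∈ Q.carrier) ∧
          ReflTransGen (ChainStep Q δ η (↑𝒯.acc) 𝒯.O) z₀ (meshPoint δ v) := by
      intro j hj
      induction hj with
      | refl => exact ⟨v₀, hv₀, hhubi, hstart.mem_right, ReflTransGen.single (revStep hstart)⟩
      | @tail b c _ hst ih =>
        obtain ⟨v, hv, hhubb, hvpt, hchainv⟩ := ih
        rcases hst with ⟨-, hhubc, w, hw, w', hw', hrev⟩ | ⟨x, k, x', k', hdx, hdx', hpath⟩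
        · -- a revealed step: bridge inside the hub cell of side `b`, then follow the revealed connection
          have hbr := revPt_of_att hhubη hhubQ hhubb hv hw hvpt
          exact ⟨w', hw', hhubc, hrev.mem_right, (hchainv.tail (revStep hbr)).tail (revStep hrev)⟩
        · -- a docking bit: the attached vertex of side `b` is the docking vertex `x`
          obtain ⟨hσ, hβ, hηx, hcpt⟩ := hdx
          obtain ⟨hσ', hβ', hηx', hcpt'⟩ := hdx'
          obtain ⟨hxO, hxW, hxQ, hAx⟩ := dock_facts hacc hσ hβ hηx
          obtain ⟨hx'O, hx'W, hx'Q, hAx'⟩ := dock_facts hacc hσ' hβ' hηx'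
          obtain ⟨hout, -, -⟩ := 𝒯.hubContact_of_docking h₀ hxO hβ hcpt
          obtain ⟨hout', hhubc, hx'att⟩ := 𝒯.hubContact_of_docking h₀ hx'O hβ' hcpt'
          rw [hout] at hv
          obtain ⟨rfl, -⟩ := mem_att_σc_iff.1 hv
          have hmap : ∀ {u w : Site 2}, ReflTransGen (OpenStep 𝒯.U η) u w → ReflTransGen (AccAdj η (↑𝒯.acc)) u w := by
            intro u w h
            induction h with
            | refl => exact ReflTransGen.refl
            | tail _ hs ih' => exact ih'.tail (accAdj_of_openStep hs)
          have hwalk : ReflTransGen (AccAdj η (↑𝒯.acc)) v x' :=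
            ((ReflTransGen.single hAx).trans (hmap hpath)).tail hAx'.symm
          have hstep : ChainStep Q δ η (↑𝒯.acc) 𝒯.O (meshPoint δ v) (meshPoint δ x') :=
            Or.inr ⟨v, x', hxO, hx'O, rfl, rfl, hwalk⟩
          exact ⟨x', hx'att, hhubc, ⟨meshPoint_mem_openEdgeUnion_of_hub hhubη hx'O hx'W, hx'Q⟩, hchainv.tail hstep⟩
    obtain ⟨v, hv, hhubj, hvpt, hchainv⟩ := key j hchain
    obtain ⟨-, w, hw, hrev⟩ := hend
    have hbr := revPt_of_att hhubη hhubQ hhubj hv hw hvpt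
    exact (hchainv.tail (revStep hbr)).tail (revStep hrev)

omit hhubQ in
/-- **(⇒) Completeness of the side chain.** [cite: SchrammSmirnov2011, §4, proof of Prop. 4.1] -/
theorem sideChain_of_mem_z2QuadConfig (hQ : Q ∈ z2QuadConfig D δ η) :
    ∃ z₀ ∈ Q.side 0 ∩ openEdgeUnion δ η, ∃ z₂ ∈ Q.side 2,
      𝒯.RevPt Q δ η z₀ z₂ ∨ ∃ i j, 𝒯.StartAt d₀ Q δ η z₀ i ∧
        ReflTransGen (fun a b => 𝒯.Gst d₀ Q δ η a b ∨ 𝒯.Bit d₀ η a b) i j ∧ 𝒯.EndAt d₀ Q δ η j z₂ := by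
  have hJ := junction_mem_O (𝒯 := 𝒯) hcons hX
  obtain ⟨z₀, hz₀, z₂, hz₂, hchain⟩ := (mem_z2QuadConfig_iff_chain hδ Q hJ h0 h2 hacc).1 hQ
  refine ⟨z₀, hz₀, z₂, hz₂, ?_⟩
  -- abbreviations
  set R := fun a b => 𝒯.Gst d₀ Q δ η a b ∨ 𝒯.Bit d₀ η a b with hR
  -- the invariant
  let Inv : ℂ → Prop := fun p => 𝒯.RevPt Q δ η z₀ p ∨ ∃ i j, 𝒯.StartAt d₀ Q δ η z₀ i ∧ ReflTransGen R i j ∧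
    𝒯.hubContact d₀ j ∧ ∃ v ∈ 𝒯.att (𝒯.outCell d₀ j), 𝒯.RevPt Q δ η (meshPoint δ v) p
  -- the dock-chain invariant
  let J : Site 2 → Prop := fun c => ∃ i j, 𝒯.StartAt d₀ Q δ η z₀ i ∧ ReflTransGen R i j ∧ 𝒯.hubContact d₀ j ∧
    𝒯.outCell d₀ j = σc c ∧ c ∈ 𝒯.O ∧ meshPoint δ c ∈ openEdgeUnion δ (η \ ↑𝒯.acc) ∧ meshPoint δ c ∈ Q.carrier
  -- folding docking pieces
  have fold : ∀ c b, J c → ReflTransGen (fun x y => x ∈ 𝒯.O ∧ y ∈ 𝒯.O ∧ 𝒯.DockPiece η x y) c b → J b := by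
    intro c b hJc hcb
    induction hcb with
    | refl => exact hJc
    | @tail c' c'' _ hpiece ih =>
      obtain ⟨i, j, hstart, hrtg, hhubj, houtj, hc'O, hc'pt, hc'Q⟩ := ih
      obtain ⟨-, hc''O, k, k', hσ, hβ, hηc, hσ', hβ', hηc', hpath⟩ := hpiece
      obtain ⟨-, hc'W, -, -⟩ := dock_facts hacc hσ hβ hηc
      obtain ⟨-, hc''W, hc''Q, -⟩ := dock_facts hacc hσ' hβ' hηc'
      obtain ⟨ic, -, hcpt, houtic, hhubic, hattic⟩ := exists_side_of_dock h₀ hσ hβ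
      obtain ⟨j', -, hcpt', houtj', hhubj', hattj'⟩ := exists_side_of_dock h₀ hσ' hβ'
      have hbit : 𝒯.Bit d₀ η ic j' := ⟨c', k, c'', k', ⟨hσ, hβ, hηc, hcpt⟩, ⟨hσ', hβ', hηc', hcpt'⟩, hpath⟩
      have hgst : 𝒯.Gst d₀ Q δ η j ic := by
        refine ⟨hhubj, hhubic, c', ?_, c', hattic, RevPt.of_mem hc'pt hc'Q⟩
        rw [houtj]; exact mem_att_σc_iff.2 ⟨rfl, hc'O⟩
      exact ⟨i, j', hstart, (hrtg.tail (Or.inl hgst)).tail (Or.inr hbit), hhubj', houtj', hc''O,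
        meshPoint_mem_openEdgeUnion_of_hub (δ := δ) hhubη hc''O hc''W, hc''Q⟩
  -- the main induction along the chain
  have main : ∀ q, ReflTransGen (ChainStep Q δ η (↑𝒯.acc) 𝒯.O) z₀ q → Inv q := by
    intro q hq
    induction hq with
    | refl =>
      exact Or.inl (RevPt.of_mem (mem_openEdgeUnion_sdiff_of_side0 h0 hz₀.1 hz₀.2) (Q.side_subset_carrier 0 hz₀.1))
    | @tail p q _ hstep ih =>
      rcases hstep with ⟨S, hS, hSc, hp, hq⟩ | ⟨a, b, haO, hbO, rfl, rfl, hab⟩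
      · -- a revealed step
        have hpq : 𝒯.RevPt Q δ η p q := ⟨S, hS, hSc, hp, hq⟩
        rcases ih with h | ⟨i, j, hstart, hrtg, hhubj, v, hv, hrev⟩
        · exact Or.inl (h.trans hpq)
        · exact Or.inr ⟨i, j, hstart, hrtg, hhubj, v, hv, hrev.trans hpq⟩
      · -- a docking walk: split it into pieces
        have hd := exists_dockChain_of_accAdj haO hbO hab
        rcases hd.cases_head with rfl | ⟨c, hfirst, hrest⟩
        · exact ih
        · -- the first piece docks at `a`: establish `J a`
          obtain ⟨-, -, k, k', hσa, hβa, hηa, -⟩ := hfirst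
          obtain ⟨-, haW, haQ, -⟩ := dock_facts hacc hσa hβa hηa
          have hapt := meshPoint_mem_openEdgeUnion_of_hub (δ := δ) hhubη haO haW
          obtain ⟨ia, -, -, houtia, hhubia, hattia⟩ := exists_side_of_dock h₀ hσa hβa
          have hJa : J a := by
            rcases ih with h | ⟨i, j, hstart, hrtg, hhubj, v, hv, hrev⟩
            · exact ⟨ia, ia, ⟨hhubia, a, hattia, h⟩, ReflTransGen.refl, hhubia, houtia, haO, hapt, haQ⟩
            · have hgst : 𝒯.Gst d₀ Q δ η j ia := ⟨hhubj, hhubia, v, hv, a, hattia, hrev⟩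
              exact ⟨i, ia, hstart, hrtg.tail (Or.inl hgst), hhubia, houtia, haO, hapt, haQ⟩
          obtain ⟨i, j, hstart, hrtg, hhubj, houtj, -, hbpt, hbQ⟩ := fold a b hJa hd
          refine Or.inr ⟨i, j, hstart, hrtg, hhubj, b, ?_, RevPt.of_mem hbpt hbQ⟩
          rw [houtj]; exact mem_att_σc_iff.2 ⟨rfl, hbO⟩
  rcases main z₂ hchain with h | ⟨i, j, hstart, hrtg, hhubj, v, hv, hrev⟩
  · exact Or.inl h
  · exact Or.inr ⟨i, j, hstart, hrtg, ⟨hhubj, v, hv, hrev⟩⟩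

/-- **The crossing event of the cut quad at the resolution of the loop sides**: the quad is crossed
iff a point of `∂₀Q` on a drawn open edge is joined to `∂₂Q` either by a revealed connection, or
through a chain of loop sides linked alternately by revealed steps (`Gst`) and docking bits (`Bit`).
[cite: SchrammSmirnov2011, §4, proof of Prop. 4.1 ("ω̃ ∈ ⊞_{Q₀} iff there is a path from ∂₀Q₀ to ∂₂Q₀ in G ∪ G*")] -/
theorem mem_z2QuadConfig_iff_sideChain :
    Q ∈ z2QuadConfig D δ η ↔ ∃ z₀ ∈ Q.side 0 ∩ openEdgeUnion δ η, ∃ z₂ ∈ Q.side 2,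
      𝒯.RevPt Q δ η z₀ z₂ ∨ ∃ i j, 𝒯.StartAt d₀ Q δ η z₀ i ∧
        ReflTransGen (fun a b => 𝒯.Gst d₀ Q δ η a b ∨ 𝒯.Bit d₀ η a b) i j ∧ 𝒯.EndAt d₀ Q δ η j z₂ :=
  ⟨sideChain_of_mem_z2QuadConfig h₀ hδ hcons hX hhubη h0 h2 hacc,
    fun ⟨_, hz₀, _, hz₂, h⟩ => mem_z2QuadConfig_of_sideChain h₀ hδ hhubη hhubQ hacc hz₀.1 hz₀.2 hz₂ h⟩

end SideChain

end TileData

end CellComplex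

end Literature.Probability.Percolation

end
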